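import Literature.AlgebraicGeometry.Resolution.GabberTemkinAlterations
import Literature.AlgebraicGeometry.Resolution.AlterationsStrong
import Mathlib.RingTheory.Unramified.Field
import Mathlib.AlgebraicGeometry.Morphisms.Etale
import HarnessLib

/-!
# A generically étale alteration is separable (de Jong 1996, 2.20)

Topic `Literature/AlgebraicGeometry/Resolution`; companion of `AlterationsStrong.lean`
(`IsGenericallyEtale`, de Jong 1996, 2.6, and the named fact `DeJong1996StrongPerfect`: over a perfect
field de Jong's alteration "may be chosen generically étale") and `GabberTemkinAlterations.lean`
(`IsAlteration.IsSeparable`: the function field extension `K(X₁)/K(X)` is separable — Illusie–Laszlo–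
Orgogozo 2014, Exp. X 3.3.1; the separability clauses of `GabberPrimeToEllAlteration` /
`Temkin2017PAlteration` are stated in this form). De Jong 1996, 2.20 (p. 61): "We remark that an
alteration `S' → S` is generically étale if and only if the (finite) extension of function fields
`R(S) ⊂ R(S')` is separable." This file PROVES the implication used to pass from the first phrasing
to the second (no named facts):

* `formallyUnramified_functionFieldOver_of_isGenericallyEtale` — for a dominant morphism
  `φ : X₁ → X` of integral schemes which is étale on a dense open `U ⊆ X₁`, the extension
  `K(X) → K(X₁)` is formally unramified: at a point `x ∈ U` the stalk map `𝒪_{X,φx} → 𝒪_{X₁,x}` is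
  formally unramified (Mathlib: étale ⇒ formally unramified, `FormallyUnramified.stalkMap`, after
  cancelling the stalk isomorphism of the open immersion `U ↪ X₁`), `𝒪_{X₁,x} → K(X₁)` is a
  localisation, hence `𝒪_{X,φx} → K(X₁)` is formally unramified, and so is `K(X) → K(X₁)` since
  `K(X) = Frac 𝒪_{X,φx}` sits in between (`Algebra.FormallyUnramified.of_restrictScalars`);
* `isSeparable_functionFieldOver_of_isGenericallyEtale` — if moreover `K(X₁)/K(X)` is finite (e.g.
  `φ` an alteration), it is separable (Mathlib `Algebra.FormallyUnramified.iff_isSeparable`: for an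
  essentially-of-finite-type extension of fields, formally unramified ⟺ separable);
* `IsAlteration.isSeparable_of_isGenericallyEtale` — a generically étale alteration is a separable
  alteration (`IsAlteration.IsSeparable`);
* `DeJong1996StrongPerfect.exists_isRegular_isSeparable` — consequently the named fact
  `DeJong1996StrongPerfect` (Thm. 4.1, last sentence) yields, over a perfect field, a REGULAR
  SEPARABLE alteration of every variety (no degree bound), in the currency of
  `GabberPrimeToEllAlteration` / `Temkin2017PAlteration`.

The converse direction of 2.20 (separable ⇒ generically étale: spread out an étale generic fibre) is
not treated here. -- TODO(general form): the converse.

## Sources (text in hand, read 2026-08-26)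

* A. J. de Jong, *Smoothness, semi-stability and alterations*, Publ. Math. IHÉS 83 (1996), 2.6 (p. 55:
  generically étale) and 2.20, p. 61 (held `doi:10.1007/bf02698644`, PDF p. 12 l. 14–16: "We remark
  that an alteration `S' → S` is generically étale if and only if the (finite) extension of function
  fields `R(S) ⊂ R(S')` is separable"). [DeJong1996]
* L. Illusie, Y. Laszlo, F. Orgogozo (eds.), Astérisque 363–364 (2014), Exp. X 3.3.1 (separable
  alteration), as quoted in `GabberTemkinAlterations.lean`. [IllusieLaszloOrgogozo2014]
-/

noncomputable section

open CategoryTheory AlgebraicGeometry TopologicalSpace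

namespace Literature.AlgebraicGeometry.Resolution

universe u

open Literature.AlgebraicGeometry.Motives Literature.AlgebraicGeometry.Motives.RatFn

/-- **The stalk maps of a generically étale morphism are formally unramified on the étale locus**:
if `U.ι ≫ φ` is étale for an open `U ⊆ X₁`, then for `x ∈ U` the ring map `𝒪_{X, φ x} → 𝒪_{X₁, x}`
is formally unramified (étale ⇒ formally unramified on stalks; the stalk map of the open immersion
`U ↪ X₁` is an isomorphism). [cite: DeJong1996, 2.6, p. 55] -/
theorem formallyUnramified_stalkMap_of_etale_restrict {X₁ X : Scheme.{u}} (φ : X₁ ⟶ X)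
    (U : X₁.Opens) [Etale (U.ι ≫ φ)] (x : X₁) (hx : x ∈ U) :
    (φ.stalkMap x).hom.FormallyUnramified := by
  let u : (U : Scheme.{u}) := ⟨x, hx⟩
  have h1 : ((U.ι ≫ φ).stalkMap u).hom.FormallyUnramified := FormallyUnramified.stalkMap (U.ι ≫ φ) u
  rw [Scheme.Hom.stalkMap_comp] at h1
  -- `h1 : (φ.stalkMap (U.ι u) ≫ U.ι.stalkMap u).hom` formally unramified; cancel the iso on the left
  let e : X₁.presheaf.stalk (U.ι.base u) ≅ (U : Scheme.{u}).presheaf.stalk u := asIso (U.ι.stalkMap u)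
  have h2 : ((φ.stalkMap (U.ι.base u) ≫ e.hom) ≫ e.inv).hom.FormallyUnramified := by
    rw [CommRingCat.hom_comp]
    have := RingHom.FormallyUnramified.respectsIso.1 (φ.stalkMap (U.ι.base u) ≫ e.hom).hom
      e.symm.commRingCatIsoToRingEquiv h1
    exact this
  have h3 : (φ.stalkMap (U.ι.base u)).hom.FormallyUnramified := by
    simpa [Category.assoc, Iso.hom_inv_id, Category.comp_id] using h2
  exact h3

/-- **A generically étale dominant morphism of integral schemes induces a formally unramified
extension of function fields** `K(X) → K(X₁)` (de Jong 1996, 2.20: generically étale ⇒ the extension of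
function fields is separable — here the formally-unramified half, for any dominant `φ` étale on a dense
open). [cite: DeJong1996, 2.20, p. 61] -/
theorem formallyUnramified_functionFieldOver_of_isGenericallyEtale {X₁ X : Scheme.{u}} [IsIntegral X]
    [IsIntegral X₁] (φ : X₁ ⟶ X) [IsDominant φ] (hφ : IsGenericallyEtale φ) :
    Algebra.FormallyUnramified X.functionField (FunctionFieldOver φ) := by
  obtain ⟨U, hU, hUet⟩ := hφ
  haveI := hUet
  -- a point of the dense (hence non-empty) open `U`
  obtain ⟨x, hx⟩ : (U : Set X₁).Nonempty := hU.nonempty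
  -- the four rings: `A = 𝒪_{X, φ x} → R = K(X)`, `B = 𝒪_{X₁, x} → S = K(X₁)`
  let A := X.presheaf.stalk (φ.base x)
  let B := X₁.presheaf.stalk x
  let s : A →+* B := (φ.stalkMap x).hom
  have hs : s.FormallyUnramified := formallyUnramified_stalkMap_of_etale_restrict φ U x hx
  letI algAB : Algebra A B := s.toAlgebra
  haveI : Algebra.FormallyUnramified A B := hs
  -- `B → K(X₁)` (as the `K(X)`-algebra `FunctionFieldOver φ`) is the localisation at the generic point
  letI algBS : Algebra B (FunctionFieldOver φ) := (toFunctionField x : B →+* X₁.functionField).toAlgebra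
  haveI : IsFractionRing B (FunctionFieldOver φ) :=
    inferInstanceAs (IsFractionRing (X₁.presheaf.stalk x) X₁.functionField)
  haveI : Algebra.FormallyUnramified B (FunctionFieldOver φ) :=
    Algebra.FormallyUnramified.of_isLocalization (nonZeroDivisors B)
  -- `A → K(X₁)` through `B`
  letI algAS : Algebra A (FunctionFieldOver φ) :=
    ((algebraMap B (FunctionFieldOver φ)).comp (algebraMap A B)).toAlgebra
  haveI : IsScalarTower A B (FunctionFieldOver φ) := IsScalarTower.of_algebraMap_eq' rfl
  haveI : Algebra.FormallyUnramified A (FunctionFieldOver φ) :=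
    Algebra.FormallyUnramified.comp A B (FunctionFieldOver φ)
  -- `A → K(X) → K(X₁)` is the same map (`φ♯ ∘ (𝒪_{X,φx} → K(X)) = (𝒪_{X₁,x} → K(X₁)) ∘ φ♯_x`)
  haveI : IsScalarTower A X.functionField (FunctionFieldOver φ) := by
    refine IsScalarTower.of_algebraMap_eq fun t => ?_
    change toFunctionField x (φ.stalkMap x t) =
      FunctionFieldOver.of φ (functionFieldMap φ (toFunctionField (φ.base x) t))
    rw [functionFieldMap_toFunctionField]
    rfl
  exact Algebra.FormallyUnramified.of_restrictScalars (R := A) X.functionField (FunctionFieldOver φ)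

/-- **Generically étale ⇒ separable function field extension**, for a dominant morphism of integral
schemes with `K(X₁)/K(X)` finite (de Jong 1996, 2.20: "an alteration `S' → S` is generically étale if
and only if the (finite) extension of function fields `R(S) ⊂ R(S')` is separable" — the direction
"⇒"; Mathlib: a formally unramified essentially-finite-type field extension is separable).
[cite: DeJong1996, 2.20, p. 61] -/
theorem isSeparable_functionFieldOver_of_isGenericallyEtale {X₁ X : Scheme.{u}} [IsIntegral X]
    [IsIntegral X₁] (φ : X₁ ⟶ X) [IsDominant φ]
    [FiniteDimensional X.functionField (FunctionFieldOver φ)] (hφ : IsGenericallyEtale φ) :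
    Algebra.IsSeparable X.functionField (FunctionFieldOver φ) := by
  haveI := formallyUnramified_functionFieldOver_of_isGenericallyEtale φ hφ
  exact (Algebra.FormallyUnramified.iff_isSeparable X.functionField (FunctionFieldOver φ)).mp
    inferInstance

/-- **A generically étale alteration is separable** (de Jong 1996, 2.20, "⇒": the separability
clause `IsAlteration.IsSeparable` of Illusie–Laszlo–Orgogozo 2014, Exp. X 3.3.1 follows from generic
étaleness, de Jong 1996, 2.6 — e.g. for the alteration of `DeJong1996StrongPerfect` over a perfect
field). [cite: DeJong1996, 2.20, p. 61]
[cite: IllusieLaszloOrgogozo2014, Exp. X 3.3.1 (arXiv:1207.3648v1 p. 158)] -/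
theorem IsAlteration.isSeparable_of_isGenericallyEtale {X₁ X : Scheme.{u}} [IsIntegral X]
    {φ : X₁ ⟶ X} (h : IsAlteration φ) (hφ : IsGenericallyEtale φ) : h.IsSeparable := by
  haveI : IsIntegral X₁ := h.isIntegral
  haveI : IsDominant φ := h.isDominant
  haveI : FiniteDimensional X.functionField (FunctionFieldOver φ) :=
    h.finiteDimensional_functionFieldOver
  rw [h.isSeparable_iff]
  exact isSeparable_functionFieldOver_of_isGenericallyEtale φ hφ

/-! ## De Jong's theorem over a perfect field gives a separable regular alteration -/

/-- **De Jong 1996, Thm. 4.1 over a perfect field, in the separable-alteration currency**: from the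
named fact `DeJong1996StrongPerfect` ("If `k` is perfect then the alteration `φ₁` may be chosen to be
generically étale", de Jong 1996, Thm. 4.1, last sentence, p. 66), every variety `X` over a perfect
field `k` (integral, separated, of finite type) has an alteration `φ : X₁ → X` with `X₁` REGULAR and
`K(X₁)/K(X)` SEPARABLE (`IsAlteration.IsSeparable`, by 2.20 / `IsAlteration.isSeparable_of_isGenericallyEtale`;
`X₁` is regular as an open subscheme of the regular projective `X̄₁`). No degree bound is asserted (de
Jong gives none); compare `GabberPrimeToEllAlteration` (degree prime to one `ℓ ≠ p`) and
`Temkin2017PAlteration` (degree a power of `p`, separable if `k` is perfect).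
[cite: DeJong1996, Thm. 4.1 (last sentence) and 2.20, pp. 61, 66] -/
theorem DeJong1996StrongPerfect.exists_isRegular_isSeparable (h : DeJong1996StrongPerfect.{u})
    (k : Type u) [Field k] [PerfectField k] (X : Scheme.{u}) [IsIntegral X] (f : X ⟶ Spec (.of k))
    [IsSeparated f] [LocallyOfFiniteType f] [QuasiCompact f] :
    ∃ (X₁ : Scheme.{u}) (φ : X₁ ⟶ X) (hφ : IsAlteration φ), Scheme.IsRegular X₁ ∧ hφ.IsSeparable := by
  have hne : (∅ : Set X) ≠ Set.univ := fun e =>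
    (Set.univ_eq_empty_iff.mp e.symm).false (genericPoint X)
  obtain ⟨X₁, Xbar₁, φ₁, j₁, g, hφ, hj, -, -, hreg, -, -, het⟩ :=
    h k X f ∅ ‹_› ‹_› ‹_› ‹_› isClosed_empty hne
  haveI := hj
  exact ⟨X₁, φ₁, hφ, hreg.of_isOpenImmersion j₁, hφ.isSeparable_of_isGenericallyEtale het⟩

end Literature.AlgebraicGeometry.Resolution

end
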